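import Summits.BirchSwinnertonDyer.BirchSwinnertonDyer.Theorems.EisensteinPrimesMazurMCOnCellBTwistbackSubrowDatumOfKernelDiscTypes
import Summits.BirchSwinnertonDyer.BirchSwinnertonDyer.Theorems.EisensteinPrimesMazurMCOnCellBTwistbackDisplays01
import Summits.BirchSwinnertonDyer.Rank1Residual.X2.RouteGSplitDisplay72384k1Local
import Summits.BirchSwinnertonDyer.Rank1Residual.Partition.EisensteinKernelCertificate
import Mathlib.Tactic.NormNum.LegendreSymbol
import HarnessLib

/-!
# Crux 3 `MazurMCOnCellB` (stmt-BirchSwinnertonDyer-19033), line `twistback` v5/v6 — sub-row census cell `(72384k1, 3)`: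
# ON THE CLOSED SUB-ROW IN THE KERNEL (unconditionally), and stub 6′'s (∃-PARTNER) there from the rank reading alone

Width seat bsd-line-x2-p1-w7 (gen 2), cell `bsd-eis` (run/shared/lean/pub/bsd-eis/), 2026-08-28; GENERATED by
`work/gen_cell.py` (this seat) from the farm-checked template of parts 6–7 (`…SubrowCell5568g1`, `…SubrowDatumOfKernelDisc`),
the tree's per-pair lemmas of lam-a g16 (`EisensteinPrimesMazurMCOnCellBTwistbackDisplays01.Cell72384k1`: `eval_Ψ₃_72384k1`, `cellB_72384k1_of_analyticRank`) and of the
route-G display (`X2/RouteGSplitDisplay72384k1Local`: `isElliptic_72384k1`, `isGloballyMinimal_72384k1`, `nonsplit_72384k1`),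
REUSED BY NAME; below the module docstring nothing is hand-edited. HONEST FRAMING (FULL-BSD rank-`≤ 1` programme D-0033; row
A10 = X2b, census `HOME/lam-a-g16/ca/cells.tsv`): §2 is an UNCONDITIONAL kernel theorem (no reading, no named fact); §3 is
CONDITIONAL on the named facts BY NAME — the route's `PublishedInputs`, Disegni 2020 Thm. 4(1) `padicBSD_rankOne_nonsplitMult`,
Greenberg–Vatsal Thm. (3.11) `thm311_…`, Disegni 2020 Thm. 2.4 `padicGrossZagier_nonsplitMult`, Nakagawa–Horie 1988 + Taya 2000
(all PUBLISHED) — and on ONE instrument reading `hr : r_an(72384k1) = 0` [Cremona `allbsd`]. THEOREMS ONLY (no `def`, no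
named fact introduced, no `sorry`); `--supports` stmt-BirchSwinnertonDyer-19033; closes no stub; nothing is booked, no label /
count / tier moves; `(72384k1, 3)` stays OPEN on TARGET; Mazur's main conjecture / BSD is proved for NO curve; no summit statement.

DATA `W = 72384k1 = [0, -1, 0, -469, -8819]` (`N = ` bad primes `2, 3, 13, 29`; `|Δ| = 2^14·3^3·13^3·29^1`): `Ψ₃`-root
`x₀ = 43`, kernel-field certificate `2·(312)² = Ψ₂Sq(x₀) = 194688` (kernel discriminant `D = 2`); places `≠ 3`:
`2` additive; `13` non-split multiplicative; `29` split multiplicative (node-tangent root 5);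
balance `1 = 0 + 1 + 0` (`s_ℓ = 1` exactly at the one contributing place).

References: [GreenbergVatsal2000] §2 Prop. (2.4), p. 28, §3 Thm. (3.11) and p. 43; [Disegni2020] §2.2 Thm. 2.4, §3.2 Thm. 4;
[NakagawaHorie1988] Thm. 1; [SilvermanAEC2009] VII.1, VII.5 Prop. 5.1; Cremona `ecdata` (class 72384k).
-/

set_option autoImplicit false
-- `Summit.BirchSwinnertonDyer.BirchSwinnertonDyer.…`: the summit and its single sub-problem share a name.
set_option linter.dupNamespace false

noncomputable section

open scoped Classical NumberTheorySymbols

open NumberField IsDedekindDomain Field WeierstrassCurve DirichletCharacter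
  Literature.NumberTheory.EllipticCurves Literature.NumberTheory.GaloisRepresentations
  Literature.NumberTheory.EllipticCurves.GreenbergVatsal2000
  Literature.NumberTheory.EllipticCurves.Rank1Residual Literature.NumberTheory.EllipticCurves.Rank1Residual.Typed
  Literature.NumberTheory.EllipticCurves.Rank1Residual.X11RankOneCertificates
  Literature.NumberTheory.EllipticCurves.Disegni2020
  Summit.BirchSwinnertonDyer.BirchSwinnertonDyer.Rank1Residual.IntModel
  Summit.BirchSwinnertonDyer.BirchSwinnertonDyer.Rank1Residual.X11RankOne
  Summit.BirchSwinnertonDyer.Rank1Residual.X11b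
  Summit.BirchSwinnertonDyer.Rank1Residual Summit.BirchSwinnertonDyer.Rank1Residual.X2
  Summit.BirchSwinnertonDyer.Rank1Residual.X2.LocalDeltaCalculus
  Summit.BirchSwinnertonDyer.Rank1Residual.X2.RouteGSplitDisplay80934e1Local
  Summit.BirchSwinnertonDyer.Rank1Residual.X2.RouteGSplitDisplay72384k1Local
  Summit.BirchSwinnertonDyer.BirchSwinnertonDyer.Theses
  Summit.BirchSwinnertonDyer.BirchSwinnertonDyer.Theorems.EisensteinPrimesMazurMCOnCellBTwistbackDisplays01.Cell72384k1
  Summit.BirchSwinnertonDyer.BirchSwinnertonDyer.Theorems.EisensteinPrimesMazurMCOnCellBTwistbackSubrowPartnerAnyLinePAdicGZ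

namespace Summit.BirchSwinnertonDyer.BirchSwinnertonDyer.Theorems.EisensteinPrimesMazurMCOnCellBTwistbackSubrowCell72384k1

/-! ## §1 The per-pair clauses at `(72384k1, 3)` -/

/-- Distinct primes give distinct places of `ℚ`. [folklore] -/
private theorem place_ne {ℓ ℓ' : ℕ} (hℓ : ℓ.Prime) (hℓ' : ℓ'.Prime) (h : ℓ ≠ ℓ') :
    (Rat.HeightOneSpectrum.primesEquiv (R := 𝓞 ℚ)).symm ⟨ℓ, hℓ⟩ ≠
      (Rat.HeightOneSpectrum.primesEquiv (R := 𝓞 ℚ)).symm ⟨ℓ', hℓ'⟩ := by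
  intro h'
  have h'' := congrArg (fun v ↦ (Rat.HeightOneSpectrum.primesEquiv (R := 𝓞 ℚ) v : ℕ)) h'
  simp only [Equiv.apply_symm_apply] at h''
  exact h h''

/-- The residue characteristic of the place of `ℓ` is `ℓ`. [folklore] -/
private theorem natGenerator_place (ℓ : ℕ) (hℓ : ℓ.Prime) :
    Rat.HeightOneSpectrum.natGenerator ((Rat.HeightOneSpectrum.primesEquiv (R := 𝓞 ℚ)).symm ⟨ℓ, hℓ⟩) = ℓ :=
  congrArg Subtype.val (Equiv.apply_symm_apply (Rat.HeightOneSpectrum.primesEquiv (R := 𝓞 ℚ)) _)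

/-- `3 ∉ v` for the place of a prime `ℓ ≠ 3`. [folklore] -/
private theorem three_not_mem_place {ℓ : ℕ} (hℓ : ℓ.Prime) (h3 : ℓ ≠ 3) :
    ((3 : ℕ) : 𝓞 ℚ) ∉ ((Rat.HeightOneSpectrum.primesEquiv (R := 𝓞 ℚ)).symm ⟨ℓ, hℓ⟩).asIdeal := by
  intro hmem
  have h := Rat.HeightOneSpectrum.primesEquiv_eq_of_natCast_mem
    ((Rat.HeightOneSpectrum.primesEquiv (R := 𝓞 ℚ)).symm ⟨ℓ, hℓ⟩) Nat.prime_three hmem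
  rw [Equiv.apply_symm_apply] at h
  exact h3 (by simpa using h)

/-- A prime dividing `2^14·3^3·13^3·29^1` is one of `2, 3, 13, 29`. [folklore] -/
private theorem eq_of_prime_dvd {q : ℕ} (hq : q.Prime) (h : q ∣ 2 ^ 14 * 3 ^ 3 * 13 ^ 3 * 29 ^ 1) :
    q = 2 ∨ q = 3 ∨ q = 13 ∨ q = 29 := by
  have hp : ∀ {r n : ℕ}, r.Prime → q ∣ r ^ n → q = r := fun hr hd ↦
    (Nat.prime_dvd_prime_iff_eq hq hr).mp (hq.dvd_of_dvd_pow hd)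
  rcases (Nat.Prime.dvd_mul hq).mp h with h | h3
  swap
  · exact Or.inr (Or.inr (Or.inr (hp (by norm_num) h3)))
  rcases (Nat.Prime.dvd_mul hq).mp h with h | h2
  swap
  · exact Or.inr (Or.inr (Or.inl (hp (by norm_num) h2)))
  rcases (Nat.Prime.dvd_mul hq).mp h with h | h1
  swap
  · exact Or.inr (Or.inl (hp Nat.prime_three h1))
  exact Or.inl (hp Nat.prime_two h)

/-- **Good reduction of `72384k1` outside `S₀ ∪ {3}`** (`S₀` = the bad places `≠ 3`; `v`-unit discriminant).
[cite: SilvermanAEC2009, VII.5 Prop. 5.1(a)] -/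
theorem good_outside (v : HeightOneSpectrum (𝓞 ℚ)) (hv : v ∉ ({((Rat.HeightOneSpectrum.primesEquiv (R := 𝓞 ℚ)).symm ⟨2, Nat.prime_two⟩)} : Finset (HeightOneSpectrum (𝓞 ℚ))) ∪ ({((Rat.HeightOneSpectrum.primesEquiv (R := 𝓞 ℚ)).symm ⟨13, (by norm_num)⟩), ((Rat.HeightOneSpectrum.primesEquiv (R := 𝓞 ℚ)).symm ⟨29, (by norm_num)⟩)} : Finset (HeightOneSpectrum (𝓞 ℚ))))
    (h3 : ((3 : ℕ) : 𝓞 ℚ) ∉ v.asIdeal) : (⟨0, -1, 0, -469, -8819⟩ : WeierstrassCurve ℚ).HasGoodReductionAt v := by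
  set e := Rat.HeightOneSpectrum.primesEquiv (R := 𝓞 ℚ) with he
  have hq : (e v : ℕ).Prime := (e v).2
  have hv' : ∀ (ℓ : ℕ) (hℓ : ℓ.Prime), (e v : ℕ) = ℓ → v = e.symm ⟨ℓ, hℓ⟩ := by
    intro ℓ hℓ h; rw [Equiv.eq_symm_apply]; exact Subtype.ext h
  have hne : ¬ ((e v : ℕ) = 2 ∨ (e v : ℕ) = 3 ∨ (e v : ℕ) = 13 ∨ (e v : ℕ) = 29) := by
    rintro (h | h | h | h)
    · exact hv (Finset.mem_union_left _ (by rw [hv' 2 Nat.prime_two h]; simp))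
    · apply h3
      have hm := Rat.HeightOneSpectrum.natCast_natGenerator_mem v
      have h' : Rat.HeightOneSpectrum.natGenerator v = 3 := h
      rw [h'] at hm
      exact hm
    · exact hv (Finset.mem_union_right _ (by rw [hv' 13 (by norm_num) h]; simp))
    · exact hv (Finset.mem_union_right _ (by rw [hv' 29 (by norm_num) h]; simp))
  have hΔ : ¬ ((e v : ℕ) : ℤ) ∣ (⟨0, -1, 0, -469, -8819⟩ : WeierstrassCurve ℤ).Δ := by
    intro h
    rw [intCurve_Δ, Int.natCast_dvd] at h
    have habs : (discOf [0, -1, 0, -469, -8819]).natAbs = 2 ^ 14 * 3 ^ 3 * 13 ^ 3 * 29 ^ 1 := by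
      decide +kernel
    exact hne (eq_of_prime_dvd hq (habs ▸ h))
  have h := hasGoodReductionAt_map_of_not_dvd _ v hΔ
  exact (map_mk_int 0 (-1) 0 (-469) (-8819)) ▸ h

/-- **`72384k1` is ADDITIVE at `2`** (`2 ∣ c₄`, `2 ∣ Δ`; minimal model). [cite: SilvermanAEC2009, VII.5 Prop. 5.1(c)] -/
theorem additive_at_2 : (⟨0, -1, 0, -469, -8819⟩ : WeierstrassCurve ℚ).HasAdditiveReductionAt ((Rat.HeightOneSpectrum.primesEquiv (R := 𝓞 ℚ)).symm ⟨2, Nat.prime_two⟩) := by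
  haveI := isElliptic_72384k1
  haveI := isGloballyMinimal_72384k1
  have hI := integralModelInt_eq_of_map_eq (W := (⟨0, -1, 0, -469, -8819⟩ : WeierstrassCurve ℚ)) _ (map_mk_int 0 (-1) 0 (-469) (-8819))
  set v : HeightOneSpectrum (𝓞 ℚ) := ((Rat.HeightOneSpectrum.primesEquiv (R := 𝓞 ℚ)).symm ⟨2, Nat.prime_two⟩) with hvdef
  have hv : Rat.HeightOneSpectrum.primesEquiv v = ⟨2, Nat.prime_two⟩ := Equiv.apply_symm_apply _ _
  haveI : Fact (Rat.HeightOneSpectrum.primesEquiv v : ℕ).Prime := ⟨(Rat.HeightOneSpectrum.primesEquiv v).2⟩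
  rw [hasAdditiveReductionAt_iff_of_isMinimalAt (IsGloballyMinimal.isMinimal (W := (⟨0, -1, 0, -469, -8819⟩ : WeierstrassCurve ℚ)) v),
    Δ_eq_cast hI, c₄_eq_cast hI, (Rat.HeightOneSpectrum.valuation_equiv_padicValuation v).lt_one_iff_lt_one,
    (Rat.HeightOneSpectrum.valuation_equiv_padicValuation v).lt_one_iff_lt_one, Rat.padicValuation_cast,
    Rat.padicValuation_cast, Int.padicValuation_lt_one_iff, Int.padicValuation_lt_one_iff, hv]
  exact ⟨by rw [intCurve_Δ]; decide +kernel, by rw [intCurve_c₄]; decide +kernel⟩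

/-- **`72384k1` is NON-split multiplicative at `13`** (`13 ∣ Δ`, `13 ∤ c₄`, node-tangent quadratic root-free mod `13`).
[cite: SilvermanAEC2009, VII.5 Prop. 5.1(b)] -/
theorem mult_at_13 : (⟨0, -1, 0, -469, -8819⟩ : WeierstrassCurve ℚ).HasMultiplicativeReductionAt ((Rat.HeightOneSpectrum.primesEquiv (R := 𝓞 ℚ)).symm ⟨13, (by norm_num)⟩) ∧
    ¬ (⟨0, -1, 0, -469, -8819⟩ : WeierstrassCurve ℚ).HasSplitMultiplicativeReductionAt ((Rat.HeightOneSpectrum.primesEquiv (R := 𝓞 ℚ)).symm ⟨13, (by norm_num)⟩) := by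
  haveI := isElliptic_72384k1
  haveI := isGloballyMinimal_72384k1
  have hI := integralModelInt_eq_of_map_eq (W := (⟨0, -1, 0, -469, -8819⟩ : WeierstrassCurve ℚ)) _ (map_mk_int 0 (-1) 0 (-469) (-8819))
  obtain ⟨hm, -, hns⟩ := multAt_of_intModel hI 13 (by norm_num) (by rw [intCurve_Δ]; decide +kernel)
    (by rw [intCurve_c₄]; decide +kernel)
  exact ⟨hm, hns (fun t ↦ by
    simp only [WeierstrassCurve.c₄, WeierstrassCurve.b₂, WeierstrassCurve.b₄, WeierstrassCurve.b₆]
    push_cast; revert t; decide)⟩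

/-- **`72384k1` is SPLIT multiplicative at `29`** (`29 ∣ Δ`, `29 ∤ c₄`, node-tangent root `5` mod `29`).
[cite: SilvermanAEC2009, VII.5 Prop. 5.1(b)] -/
theorem mult_at_29 : (⟨0, -1, 0, -469, -8819⟩ : WeierstrassCurve ℚ).HasMultiplicativeReductionAt ((Rat.HeightOneSpectrum.primesEquiv (R := 𝓞 ℚ)).symm ⟨29, (by norm_num)⟩) ∧
    (⟨0, -1, 0, -469, -8819⟩ : WeierstrassCurve ℚ).HasSplitMultiplicativeReductionAt ((Rat.HeightOneSpectrum.primesEquiv (R := 𝓞 ℚ)).symm ⟨29, (by norm_num)⟩) := by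
  haveI := isElliptic_72384k1
  haveI := isGloballyMinimal_72384k1
  have hI := integralModelInt_eq_of_map_eq (W := (⟨0, -1, 0, -469, -8819⟩ : WeierstrassCurve ℚ)) _ (map_mk_int 0 (-1) 0 (-469) (-8819))
  obtain ⟨hm, hsp, -⟩ := multAt_of_intModel hI 29 (by norm_num) (by rw [intCurve_Δ]; decide +kernel)
    (by rw [intCurve_c₄]; decide +kernel)
  exact ⟨hm, hsp ⟨5, by
    simp only [WeierstrassCurve.c₄, WeierstrassCurve.b₂, WeierstrassCurve.b₄, WeierstrassCurve.b₆]
    push_cast; decide⟩⟩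

/-- **The kernel-field certificate**: `2·(312)² = Ψ₂Sq(43) = 194688` for `72384k1`, so the rational `3`-line through the
`Ψ₃`-root `43` has kernel discriminant `D = 2`. [folklore] -/
theorem kernelDisc_cert : ((2 : ℤ) : ℚ) * (312 : ℚ) ^ 2 = (⟨0, -1, 0, -469, -8819⟩ : WeierstrassCurve ℚ).Ψ₂Sq.eval 43 := by
  simp only [WeierstrassCurve.Ψ₂Sq, WeierstrassCurve.b₂, WeierstrassCurve.b₄, WeierstrassCurve.b₆,
    Polynomial.eval_add, Polynomial.eval_mul, Polynomial.eval_pow, Polynomial.eval_C, Polynomial.eval_X]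
  norm_num

/-! ## §2 `(72384k1, 3)` is ON the closed sub-row, in the kernel -/

/-- **`(72384k1, 3)` is ON THE CLOSED SUB-ROW, in the kernel, UNCONDITIONALLY**: the skeleton's sub-row existential (the third
conjunct of the case split in v5/v6's `upperPartner_all`; the `hbal` of `upperPartner_at_three_of_balanceOne_of_{thmE,padicGZ}`)
at `W = 72384k1`. Witness: the rational `3`-line through the `Ψ₃`-root `43` (kernel discriminant `2`, type
`2n*` with `n = 1`), `S₀` = the bad places `≠ 3` (`A` = {2} additive, `M` =
{13, 29} multiplicative), the balance `1 = 0 + 1 + 0`. No reading, no named fact.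
[cite: GreenbergVatsal2000, §2 Prop. (2.4), p. 28 and §3 p. 43] [cite: SilvermanAEC2009, VII.5 Prop. 5.1] -/
theorem subrowDatum_72384k1 [(⟨0, -1, 0, -469, -8819⟩ : WeierstrassCurve ℚ).IsElliptic] [(⟨0, -1, 0, -469, -8819⟩ : WeierstrassCurve ℚ).IsGloballyMinimal] [Fact (Nat.Prime 3)] :
    ∃ (Φ₀ : AddSubgroup (geomTorsion (⟨0, -1, 0, -469, -8819⟩ : WeierstrassCurve ℚ) (3 : ℤ))) (m : ℕ)
        (_ : NeZero m) (φ : DirichletCharacter (ZMod 3) m) (d : ℕ) (_ : NeZero d) (ψ : DirichletCharacter (ZMod 3) d)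
        (S₀ : Finset (HeightOneSpectrum (𝓞 ℚ))),
      IsRationalLine (⟨0, -1, 0, -469, -8819⟩ : WeierstrassCurve ℚ) 3 Φ₀ ∧ φ.IsPrimitive ∧ ψ.IsPrimitive ∧
      (∀ (σ : absoluteGaloisGroup ℚ), ∀ P ∈ Φ₀,
        σ • P = (φ ((modNCyclotomicCharacter ℚ m σ : (ZMod m)ˣ) : ZMod m)).val • P) ∧
      (∀ (σ : absoluteGaloisGroup ℚ) (P : geomTorsion (⟨0, -1, 0, -469, -8819⟩ : WeierstrassCurve ℚ) (3 : ℤ)),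
        σ • P - (ψ ((modNCyclotomicCharacter ℚ d σ : (ZMod d)ˣ) : ZMod d)).val • P ∈ Φ₀) ∧
      (∀ v ∈ S₀, ((3 : ℕ) : 𝓞 ℚ) ∉ v.asIdeal) ∧
      (∀ v : HeightOneSpectrum (𝓞 ℚ), v ∉ S₀ → ((3 : ℕ) : 𝓞 ℚ) ∉ v.asIdeal →
        (⟨0, -1, 0, -469, -8819⟩ : WeierstrassCurve ℚ).HasGoodReductionAt v) ∧
      1 + ∑ v ∈ S₀, delta (⟨0, -1, 0, -469, -8819⟩ : WeierstrassCurve ℚ) 3 v =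
        ∑ v ∈ S₀, ((if φ (Rat.HeightOneSpectrum.natGenerator v : ZMod m) =
              (Rat.HeightOneSpectrum.natGenerator v : ZMod 3)
            then sFactor 3 (Rat.HeightOneSpectrum.natGenerator v) else 0) +
          (if ψ (Rat.HeightOneSpectrum.natGenerator v : ZMod d) =
              (Rat.HeightOneSpectrum.natGenerator v : ZMod 3)
            then sFactor 3 (Rat.HeightOneSpectrum.natGenerator v) else 0)) := by
  obtain ⟨Φ₀, hΦ, hker⟩ := KernelDisc.exists_isRationalLine_kernelChar_of_cert
    (W := (⟨0, -1, 0, -469, -8819⟩ : WeierstrassCurve ℚ)) (x₀ := 43) (s := 312) (D := 2)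
    eval_Ψ₃_72384k1 (by norm_num) (by norm_num) kernelDisc_cert
  haveI : NeZero (1 : ℕ) := ⟨by decide⟩
  refine EisensteinPrimesMazurMCOnCellBTwistbackSubrowDatumOfKernelDisc.exists_subrowDatum_of_kernelDisc_two_mul hΦ
    (n := 1) (by decide) squarefree_one ?_
    (({((Rat.HeightOneSpectrum.primesEquiv (R := 𝓞 ℚ)).symm ⟨2, Nat.prime_two⟩)} : Finset (HeightOneSpectrum (𝓞 ℚ))) ∪ ({((Rat.HeightOneSpectrum.primesEquiv (R := 𝓞 ℚ)).symm ⟨13, (by norm_num)⟩), ((Rat.HeightOneSpectrum.primesEquiv (R := 𝓞 ℚ)).symm ⟨29, (by norm_num)⟩)} : Finset (HeightOneSpectrum (𝓞 ℚ)))) ?_ ?_ ({((Rat.HeightOneSpectrum.primesEquiv (R := 𝓞 ℚ)).symm ⟨2, Nat.prime_two⟩)} : Finset (HeightOneSpectrum (𝓞 ℚ))) Finset.subset_union_left ?_ ?_ ?_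
  · have h2 : ((2 * ((-1 : ℤ) ^ ((1 : ℕ) / 2) * ((1 : ℕ) : ℤ)) : ℤ) : ℚ) = ((2 : ℤ) : ℚ) := by norm_num
    rw [h2]
    exact hker
  · intro v hv
    rcases Finset.mem_union.mp hv with hv | hv
    · rw [Finset.mem_singleton.mp hv]
      exact three_not_mem_place Nat.prime_two (by norm_num)
    · simp only [Finset.mem_insert, Finset.mem_singleton] at hv
      rcases hv with hv | hv
      · rw [hv]; exact three_not_mem_place (by norm_num) (by norm_num)
      · rw [hv]; exact three_not_mem_place (by norm_num) (by norm_num)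
  · intro v hv h3
    exact good_outside v hv h3
  · intro v hv
    rw [Finset.mem_singleton.mp hv]
    exact additive_at_2
  · intro v hv hvA
    rcases Finset.mem_union.mp hv with hv | hv
    · exact absurd hv hvA
    · simp only [Finset.mem_insert, Finset.mem_singleton] at hv
      rcases hv with hv | hv
      · rw [hv]; exact mult_at_13.1
      · rw [hv]; exact mult_at_29.1
  · -- the balance
    have hdisj : Disjoint ({((Rat.HeightOneSpectrum.primesEquiv (R := 𝓞 ℚ)).symm ⟨2, Nat.prime_two⟩)} : Finset (HeightOneSpectrum (𝓞 ℚ))) ({((Rat.HeightOneSpectrum.primesEquiv (R := 𝓞 ℚ)).symm ⟨13, (by norm_num)⟩), ((Rat.HeightOneSpectrum.primesEquiv (R := 𝓞 ℚ)).symm ⟨29, (by norm_num)⟩)} : Finset (HeightOneSpectrum (𝓞 ℚ))) := by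
      rw [Finset.disjoint_left]
      intro w hw hw'
      simp only [Finset.mem_insert, Finset.mem_singleton] at hw hw'
      rcases hw' with hw' | hw'
      all_goals exact place_ne (by norm_num) (by norm_num) (by norm_num) (hw.symm.trans hw')
    rw [Finset.union_sdiff_cancel_left hdisj]
    rw [Finset.sum_insert (by rw [Finset.mem_singleton]; exact place_ne (by norm_num) (by norm_num) (by norm_num)), Finset.sum_singleton]
    rw [Finset.sum_singleton]
    rw [natGenerator_place 13 (by norm_num), natGenerator_place 29 (by norm_num), natGenerator_place 2 Nat.prime_two]
    rw [if_neg mult_at_13.2]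
    rw [if_pos mult_at_29.2]
    have hs29 : sFactor 3 29 = 1 :=
      (EisensteinPrimesMazurMCOnCellBTwistbackSubrowEvaluatedBalance.sFactor_three_eq_one_iff (by norm_num)).mpr (by decide)
    norm_num [hs29, ZMod.χ₄, ZMod.χ₈]

/-! ## §3 Stub 6′ AT `(72384k1, 3)` from the rank reading, through the skeleton's own sub-row theorem -/

/-- **Stub 6′ (∃-PARTNER) AT `(72384k1, 3)` from `r_an(72384k1) = 0` ALONE, modulo PUBLISHED named facts** — v6's sub-row theorem
`upperPartner_at_three_of_balanceOne_of_padicGZ` (w3 g11, p661280) fed with `subrowDatum_72384k1`, lam-a g16's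
`cellB_72384k1_of_analyticRank` and the route-G `nonsplit_72384k1`. Named facts BY NAME: `PublishedInputs`, Disegni 2020
Thm. 4(1) and Thm. 2.4, Greenberg–Vatsal Thm. (3.11), Nakagawa–Horie–Taya (all PUBLISHED). Nothing is booked; `(72384k1, 3)`
stays OPEN on TARGET (STEP L downstream). [cite: Disegni2020, §2.2 Thm. 2.4 and §3.2 Thm. 4]
[cite: GreenbergVatsal2000, §3 Thm. (3.11)] [cite: NakagawaHorie1988, Thm. 1] -/
theorem upperPartner_72384k1_at_three_of_padicGZ (hP : EisensteinPrimes.PublishedInputs)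
    (hDis : padicBSD_rankOne_nonsplitMult) (h311 : thm311_hasUnitContent_iff_and_order_eq_of_lineRamifiedEven)
    (hDGZ : padicGrossZagier_nonsplitMult)
    (hNH : Literature.NumberTheory.QuadraticFields.nakagawaHorie_taya_exists_imaginary_h3_eq_one)
    [(⟨0, -1, 0, -469, -8819⟩ : WeierstrassCurve ℚ).IsElliptic] [(⟨0, -1, 0, -469, -8819⟩ : WeierstrassCurve ℚ).IsGloballyMinimal] [Fact (Nat.Prime 3)]
    (hr : (⟨0, -1, 0, -469, -8819⟩ : WeierstrassCurve ℚ).analyticRank = 0) :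
    ∃ (K : Type) (_ : Field K) (_ : NumberField K), IsImaginaryQuadratic K ∧
      SatisfiesHeegnerHypothesis ((⟨0, -1, 0, -469, -8819⟩ : WeierstrassCurve ℚ).conductorNorm ℤ) K ∧
      SatisfiesHeegnerHypothesis 3 K ∧
      Odd (NumberField.discr K) ∧ NumberField.discr K < -4 ∧
      ((⟨0, -1, 0, -469, -8819⟩ : WeierstrassCurve ℚ).quadraticTwist (NumberField.discr K : ℚ)).analyticRank = 1 ∧
      ∀ (Wd : WeierstrassCurve ℚ) [Wd.IsElliptic] [Wd.IsGloballyMinimal],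
        (∃ C : VariableChange ℚ, C • Wd = (⟨0, -1, 0, -469, -8819⟩ : WeierstrassCurve ℚ).quadraticTwist (NumberField.discr K : ℚ)) →
        MissingUpperBoundAt Wd 3 :=
  upperPartner_at_three_of_balanceOne_of_padicGZ hP hDis h311 hDGZ hNH (⟨0, -1, 0, -469, -8819⟩ : WeierstrassCurve ℚ)
    (cellB_72384k1_of_analyticRank hr) nonsplit_72384k1.2 subrowDatum_72384k1

end Summit.BirchSwinnertonDyer.BirchSwinnertonDyer.Theorems.EisensteinPrimesMazurMCOnCellBTwistbackSubrowCell72384k1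

end
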